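import Literature.NumberTheory.Rogawski1990.ArchCompactWallTransversalExpansion   -- ★ p842550 (A2′) (this seat): `N²Φ|_{wall} = ∫ ∂²_y|₀ Θ(g·(u t_y u⁻¹)·g⁻¹) dν` for every `u ∈ G_w`
import Mathlib.Analysis.Complex.RealDeriv
import Mathlib.Analysis.SpecialFunctions.ExpDeriv
import Mathlib.Data.Matrix.Basis
import HarnessLib

/-!
# ROAD A (A2″) part 2a — THE TRANSVERSAL SECOND DERIVATIVE AT A COMPACT WALL AS «HESSIAN + GRADIENT» AT EVERY CONJUGATE, CHART-FREE
# (Rogawski 1990 §8.2 pp. 122–123, §8.4 p. 126: the second-order germ of `Φ` across the compact wall of the compact Cartan of `U(2,1)`)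

Topic `NumberTheory/Automorphic`; namespaces `Literature.Analysis.Calculus` (§1, generic) and `Literature.NumberTheory.Automorphic.UnitaryGroup` (§2–§4).  THEOREMS ONLY (no `def`,
no instance, no notation, no axiom, no named fact, no `sorry`).  Cell `pub/hodgecm-mathlib`, ENGINE T1 (crux H413 = `stmt-HodgeConjecture-24833`); ROAD A toward the
(L_{U(2,1)}) letter N1 `stub_ArchCentralLimitU21` (price of record = A-p14 (g28) census dd43a5a7; chair F0P3a-plan (g10) WORD T9-8 (D) «(A2″) part 2 = ball-chart form»);
brick **(A2″) part 2a**, sequel of ★ (A2′) p842550 and ★ (A2″) part 1 p842668∕p842697; author A-p14 (g28), 2026-09-01.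

THE MATHEMATICS.  `G_w = archLocal L N (diagonal α) w`, `t₀ = diag ζ`, the normal torus curve `t_y = diag(ζ_k e^{iy(δ_{ki} − δ_{kj})})` through `t₀` (`i ≠ j`), `E_kk = Matrix.single k k 1`.
* §1 (generic calculus, any real normed `F ⊇` a complex structure, `Θ : F → E` of class `C²`): the SECOND-ORDER CHAIN RULE `∂²|₀(Θ∘γ) = D²Θ(γ₀)[γ′₀, γ′₀] + DΘ(γ₀)[γ″₀]`
  (`iteratedDeriv_two_comp_of_hasDerivAt`) and its instance on the exponential-affine curve `γ(y) = h + (e^{iy} − 1)A + (e^{−iy} − 1)B`: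
  `∂²|₀ = D²Θ(h)[i(A − B), i(A − B)] − DΘ(h)[A + B]` (`iteratedDeriv_two_comp_expCurve`).  The (A5) hands plug their own wall curves into the first.
* §2 (matrix algebra): `t_y = t₀ · (1 + (e^{iy} − 1)E_ii + (e^{−iy} − 1)E_jj)` (`coe_circleDiagonal_wallLine_eq`), hence for `P := ↑↑(g u)`
  `↑↑(g (u t_y u⁻¹) g⁻¹) = h + (e^{iy} − 1)(ζ_i A) + (e^{−iy} − 1)(ζ_j B)`, `h = P t₀ P⁻¹`, `A = P E_ii P⁻¹`, `B = P E_jj P⁻¹` (`coe_conj_conj_circleDiagonal_wallLine_eq`; NO wall hypothesis),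
  and THE POINTWISE FORMULA **`iteratedDeriv_two_comp_conj_conj_circleDiagonal_wallLine_eq`**: `∂²_y|₀ Θ(↑↑(g (u t_y u⁻¹) g⁻¹)) = D²Θ(h)[X, X] − DΘ(h)[ζ_i A + ζ_j B]`,
  `X = i(ζ_i A − ζ_j B)`.  HONEST POINT: `Θ` is only `ℝ`-differentiable, so the unit scalars `ζ` stay INSIDE the multilinear arguments.
* §3 (the wall): a matrix commuting with `diag ζ` commutes with the spectral idempotent `E_ii + E_jj` when `{k | ζ_k = ζ_i} = {i, j}` (`mul_single_add_single_eq_of_mul_diagonal_eq`), so for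
  `m ∈ Z(t₀)`: `↑↑(g m)(E_ii + E_jj)↑↑(g m)⁻¹ = ↑↑g (E_ii + E_jj) ↑↑g⁻¹ =: Q_g` (`conj_mul_single_add_single_conj_eq_of_mem_centralizer`) and `h = ↑↑(g t₀ g⁻¹) =: h_g`; with ★ (A2′)
  (`…wallLine_eq_integral_conj` at `u := m`) this gives **`iteratedDeriv_two_integral_wallLine_eq_integral_hessian_sub_gradient`**: at a compact-wall point (`ζ_i = ζ_j`, the `b`-block of `i`
  is `{i, j}`), for EVERY `m ∈ Z(t₀)`,  `N²Φ_Θ(t₀) = ∫_{G_w} ( D²Θ(h_g)[X_{g m}, X_{g m}] − DΘ(h_g)[ζ_i Q_g] ) dν(g)`,  `X_{g m} = (i ζ_i) • ↑↑(g m)(E_ii − E_jj)↑↑(g m)⁻¹`.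
* §4 (`N = 3`, `(i, j) = (0, 1)`): `Q_g = 1 − ↑↑g · diag(0,0,1) · ↑↑g⁻¹` (`conj_single_add_single_eq_one_sub_conj_diagonal`) — at `α = (1,1,−1)` the matrix `↑↑g·diag(0,0,1)·↑↑g⁻¹` is the
  rank-one idempotent `P(lift (g • x₀))` of ★ (A3-a) `mat_conj_kCentral_eq` and `h_g = u•1 + (v − u)•P`, so the gradient term is already a function on the ball `𝔹²`; part 2b averages
  the Hessian term over an explicit orthogonal 3-frame of `𝔰𝔲(2) ⊕ 0 ⊂ Lie Z(t₀)` to make it right-`K`-invariant (trace of `D²Θ(h_g)` on `Ad(g)𝔰𝔲(2)`), whence it descends to `𝔹²`.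
HONEST LABEL: HC_CM is proved only modulo the printed citations until rung 0 closes; calculus and matrix algebra, pays nothing by itself.

## References
* [Rogawski1990] J. D. Rogawski, *Automorphic Representations of Unitary Groups in Three Variables*, Ann. of Math. Stud. 123 (1990), §8.2 pp. 122–123, §8.4 p. 126.
* [HormanderALPDO1] L. Hörmander, *The Analysis of Linear Partial Differential Operators I*, 2nd ed. (1990), Thm. 1.1.7–1.1.9 (chain rule, differentiation of composites).
* [Varadarajan1989] V. S. Varadarajan, *An Introduction to Harmonic Analysis on Semisimple Lie Groups* (1989), §6.4 (second-order germs of orbital integrals at singular points).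
-/

set_option autoImplicit false


noncomputable section

open MeasureTheory Measure Filter Topology Set Function Metric NumberField NumberField.InfinitePlace Complex
open scoped ContDiff

namespace Literature.Analysis.Calculus

/-! ## §1 The second-order chain rule (generic) -/

section ChainRule

variable {F : Type*} [NormedAddCommGroup F] [NormedSpace ℝ F]
variable {E : Type*} [NormedAddCommGroup E] [NormedSpace ℝ E]

/-- **SECOND-ORDER CHAIN RULE ALONG A CURVE**: for `Θ : F → E` of class `C²` (over `ℝ`) and a curve `γ : ℝ → F` with `γ′ = γ\'` everywhere and `(γ\')′(0) = γ″`,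
`∂²|₀ (Θ ∘ γ) = D²Θ(γ 0)[γ′ 0, γ′ 0] + DΘ(γ 0)[γ″]` (Mathlib chain rule twice, `HasDerivAt.clm_apply`, `iteratedFDeriv_two_apply`). [cite: HormanderALPDO1, Thm. 1.1.7] -/
theorem iteratedDeriv_two_comp_of_hasDerivAt (Θ : F → E) (hΘ : ContDiff ℝ 2 Θ) (γ γ' : ℝ → F) (γ'' : F)
    (hγ : ∀ y, HasDerivAt γ (γ' y) y) (hγ' : HasDerivAt γ' γ'' 0) :
    iteratedDeriv 2 (fun y => Θ (γ y)) 0 = iteratedFDeriv ℝ 2 Θ (γ 0) ![γ' 0, γ' 0] + fderiv ℝ Θ (γ 0) γ'' := by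
  have hd : Differentiable ℝ Θ := hΘ.differentiable (by norm_num)
  have h1 : ∀ y, HasDerivAt (fun y => Θ (γ y)) (fderiv ℝ Θ (γ y) (γ' y)) y := fun y =>
    (hd (γ y)).hasFDerivAt.comp_hasDerivAt y (hγ y)
  have hderiv : deriv (fun y => Θ (γ y)) = fun y => fderiv ℝ Θ (γ y) (γ' y) := funext fun y => (h1 y).deriv
  have hfd : ContDiff ℝ 1 (fderiv ℝ Θ) := hΘ.fderiv_right (by norm_num)
  have hc : HasDerivAt (fun y => fderiv ℝ Θ (γ y)) (fderiv ℝ (fderiv ℝ Θ) (γ 0) (γ' 0)) 0 :=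
    ((hfd.differentiable (by norm_num)) (γ 0)).hasFDerivAt.comp_hasDerivAt 0 (hγ 0)
  have h2 : HasDerivAt (fun y => fderiv ℝ Θ (γ y) (γ' y)) (fderiv ℝ (fderiv ℝ Θ) (γ 0) (γ' 0) (γ' 0) + fderiv ℝ Θ (γ 0) γ'') 0 :=
    hc.clm_apply hγ'
  rw [iteratedDeriv_succ, iteratedDeriv_one, hderiv, h2.deriv, iteratedFDeriv_two_apply]
  rfl

variable [NormedSpace ℂ F] [IsScalarTower ℝ ℂ F]

/-- **THE EXPONENTIAL-AFFINE CURVE**: for `Θ : F → E` of class `C²` and `h A B ∈ F` (`F` a complex normed space, differentiated over `ℝ`),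
`∂²_y|₀ Θ(h + (e^{iy} − 1)•A + (e^{−iy} − 1)•B) = D²Θ(h)[i•(A − B), i•(A − B)] − DΘ(h)[A + B]` (`γ′(0) = i(A − B)`, `γ″(0) = −(A + B)`). [cite: HormanderALPDO1, Thm. 1.1.7] -/
theorem iteratedDeriv_two_comp_expCurve (Θ : F → E) (hΘ : ContDiff ℝ 2 Θ) (h A B : F) :
    iteratedDeriv 2 (fun y : ℝ => Θ (h + (cexp (y * I) - 1) • A + (cexp (-(y * I)) - 1) • B)) 0 =
      iteratedFDeriv ℝ 2 Θ h ![I • (A - B), I • (A - B)] - fderiv ℝ Θ h (A + B) := by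
  -- the two exponentials and their first two derivatives along `ℝ`
  have he₁ : ∀ y : ℝ, HasDerivAt (fun y : ℝ => cexp (y * I) - 1) (cexp (y * I) * I) y := fun y =>
    (((Complex.hasDerivAt_exp ((y : ℂ) * I)).comp (y : ℂ) (hasDerivAt_mul_const I)).comp_ofReal).sub_const 1
  have he₂ : ∀ y : ℝ, HasDerivAt (fun y : ℝ => cexp (-(y * I)) - 1) (cexp (-(y * I)) * -I) y := fun y =>
    (((Complex.hasDerivAt_exp (-((y : ℂ) * I))).comp (y : ℂ) (hasDerivAt_mul_const I).neg).comp_ofReal).sub_const 1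
  have he₁' : ∀ y : ℝ, HasDerivAt (fun y : ℝ => cexp (y * I) * I) (cexp (y * I) * I * I) y := fun y =>
    (((Complex.hasDerivAt_exp ((y : ℂ) * I)).comp (y : ℂ) (hasDerivAt_mul_const I)).comp_ofReal).mul_const I
  have he₂' : ∀ y : ℝ, HasDerivAt (fun y : ℝ => cexp (-(y * I)) * -I) (cexp (-(y * I)) * -I * -I) y := fun y =>
    (((Complex.hasDerivAt_exp (-((y : ℂ) * I))).comp (y : ℂ) (hasDerivAt_mul_const I).neg).comp_ofReal).mul_const (-I)
  have hγ : ∀ y : ℝ, HasDerivAt (fun y : ℝ => h + (cexp (y * I) - 1) • A + (cexp (-(y * I)) - 1) • B)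
      (0 + (cexp (y * I) * I) • A + (cexp (-(y * I)) * -I) • B) y := fun y =>
    ((hasDerivAt_const y h).add ((he₁ y).smul_const A)).add ((he₂ y).smul_const B)
  have hγ' : HasDerivAt (fun y : ℝ => 0 + (cexp (y * I) * I) • A + (cexp (-(y * I)) * -I) • B)
      (0 + (cexp ((0 : ℝ) * I) * I * I) • A + (cexp (-((0 : ℝ) * I)) * -I * -I) • B) 0 :=
    ((hasDerivAt_const (0 : ℝ) (0 : F)).add ((he₁' 0).smul_const A)).add ((he₂' 0).smul_const B)
  have key := iteratedDeriv_two_comp_of_hasDerivAt Θ hΘ _ _ _ hγ hγ'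
  rw [key]
  simp only [ofReal_zero, zero_mul, neg_zero, Complex.exp_zero, one_mul, sub_self, zero_smul, add_zero, zero_add, mul_neg, neg_mul, I_mul_I,
    neg_neg, neg_smul, one_smul]
  simp only [sub_eq_add_neg, neg_add, map_neg, map_add, smul_add, smul_neg]

end ChainRule

end Literature.Analysis.Calculus

namespace Literature.NumberTheory.Automorphic.UnitaryGroup

open Literature.Analysis.Calculus
open scoped Matrix MatrixGroups
open scoped Matrix.Norms.Operator

/-! ## §2 The normal torus curve and its double conjugates are exponential-affine -/

section WallCurve

variable (N : ℕ)

/-- `diag d · E_ii(c) = d_i • E_ii(c)` (`E_ii(c) = Matrix.single i i c = diag(Pi.single i c)`; private plumbing). [folklore] -/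
private theorem diagonal_mul_single_same (d : Fin N → ℂ) (i : Fin N) (c : ℂ) :
    Matrix.diagonal d * Matrix.single i i c = d i • Matrix.single i i c := by
  rw [← Matrix.diagonal_single, Matrix.diagonal_mul_diagonal, ← Matrix.diagonal_smul]
  congr 1
  funext k
  by_cases hk : k = i
  · subst hk; simp
  · simp [hk]

/-- **THE NORMAL TORUS CURVE FACTORS THROUGH TWO IDEMPOTENTS**: for `i ≠ j`, `diag(ζ_k e^{iy(δ_{ki} − δ_{kj})}) = diag ζ · (1 + (e^{iy} − 1)•E_ii + (e^{−iy} − 1)•E_jj)`.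
[cite: Rogawski1990, §8.4 p. 126] -/
theorem coe_circleDiagonal_wallLine_eq {i j : Fin N} (hij : i ≠ j) (ζ : Fin N → Circle) (y : ℝ) :
    ((circleDiagonal N fun k => ζ k * Circle.exp (y * ((if k = i then 1 else 0) - (if k = j then 1 else 0))) : GL (Fin N) ℂ) :
        Matrix (Fin N) (Fin N) ℂ) =
      (Matrix.diagonal fun k => (ζ k : ℂ)) *
        (1 + (cexp (y * I) - 1) • Matrix.single i i (1 : ℂ) + (cexp (-(y * I)) - 1) • Matrix.single j j (1 : ℂ)) := by
  rw [coe_circleDiagonal]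
  have hC : (1 : Matrix (Fin N) (Fin N) ℂ) + (cexp (y * I) - 1) • Matrix.single i i (1 : ℂ) + (cexp (-(y * I)) - 1) • Matrix.single j j (1 : ℂ) =
      Matrix.diagonal fun k => if k = i then cexp (y * I) else if k = j then cexp (-(y * I)) else 1 := by
    rw [← Matrix.diagonal_one, ← Matrix.diagonal_single, ← Matrix.diagonal_single, ← Matrix.diagonal_smul, ← Matrix.diagonal_smul,
      Matrix.diagonal_add, Matrix.diagonal_add]
    congr 1
    funext k
    by_cases hki : k = i
    · subst hki; simp [hij]
    · by_cases hkj : k = j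
      · subst hkj; simp [hki]
      · simp [hki, hkj]
  rw [hC, Matrix.diagonal_mul_diagonal]
  congr 1
  funext k
  rw [Circle.coe_mul, Circle.coe_exp]
  by_cases hki : k = i
  · subst hki; simp [hij]
  · by_cases hkj : k = j
    · subst hkj; simp [hki, Complex.ofReal_neg, neg_mul]
    · simp [hki, hkj]

/-- **WHAT COMMUTES WITH `diag ζ` COMMUTES WITH ITS SPECTRAL IDEMPOTENTS**: if `M · diag d = diag d · M` and the `d`-class of `i` is exactly `{i, j}` (`i ≠ j`), then
`M (E_ii + E_jj) = (E_ii + E_jj) M` (`M_{kl} = 0` unless `d_k = d_l`, entrywise) — the centraliser of a singular diagonal element preserves its eigenspaces. [cite: Rogawski1990, §8.2 p. 122] -/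
theorem mul_single_add_single_eq_of_mul_diagonal_eq {d : Fin N → ℂ} {M : Matrix (Fin N) (Fin N) ℂ} (hM : M * Matrix.diagonal d = Matrix.diagonal d * M)
    {i j : Fin N} (hij : i ≠ j) (hS : ∀ k, d k = d i ↔ (k = i ∨ k = j)) :
    M * (Matrix.single i i (1 : ℂ) + Matrix.single j j 1) = (Matrix.single i i (1 : ℂ) + Matrix.single j j 1) * M := by
  have hE : Matrix.single i i (1 : ℂ) + Matrix.single j j 1 = Matrix.diagonal fun k => if d k = d i then (1 : ℂ) else 0 := by
    rw [← Matrix.diagonal_single, ← Matrix.diagonal_single, Matrix.diagonal_add]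
    congr 1
    funext k
    by_cases hki : k = i
    · subst hki; simp [hij]
    · by_cases hkj : k = j
      · subst hkj
        have : d k = d i := (hS k).2 (Or.inr rfl)
        simp [hki, this]
      · have : d k ≠ d i := fun h => by rcases (hS k).1 h with h' | h' <;> contradiction
        simp [hki, hkj, this]
  rw [hE]
  ext k l
  rw [Matrix.mul_diagonal, Matrix.diagonal_mul]
  have hkl := congr_fun (congr_fun hM k) l
  rw [Matrix.mul_diagonal, Matrix.diagonal_mul] at hkl
  by_cases hd : d k = d l
  · have : (if d l = d i then (1 : ℂ) else 0) = if d k = d i then (1 : ℂ) else 0 := by rw [hd]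
    rw [this, mul_comm]
  · have h0 : M k l = 0 := by
      have h1 : M k l * (d l - d k) = 0 := by rw [mul_sub, hkl, mul_comm, sub_self]
      rcases mul_eq_zero.1 h1 with h | h
      · exact h
      · exact absurd (sub_eq_zero.1 h).symm hd
    rw [h0, zero_mul, mul_zero]

end WallCurve

section Conjugate

variable (L : Type) [Field L] (N : ℕ) (α : Fin N → L) (w : {w : InfinitePlace L // IsComplex w})

/-- **THE DOUBLY CONJUGATED NORMAL CURVE IS EXPONENTIAL-AFFINE**: for `i ≠ j`, `g u ∈ G_w` and `P := ↑↑(g u)`,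
`↑↑(g·(u·t_y·u⁻¹)·g⁻¹) = ↑↑((g u) t₀ (g u)⁻¹) + (e^{iy} − 1)•(ζ_i • P E_ii ↑↑(g u)⁻¹) + (e^{−iy} − 1)•(ζ_j • P E_jj ↑↑(g u)⁻¹)` (§2 factorisation and `diag ζ · E_kk = ζ_k E_kk`);
no wall hypothesis. [cite: Rogawski1990, §8.4 p. 126] -/
theorem coe_conj_conj_circleDiagonal_wallLine_eq {i j : Fin N} (hij : i ≠ j) (ζ : Fin N → Circle) (g u : archLocal L N (Matrix.diagonal α) w) (y : ℝ) :
    ((((g * (u * ⟨circleDiagonal N fun k => ζ k * Circle.exp (y * ((if k = i then 1 else 0) - (if k = j then 1 else 0))),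
        circleDiagonal_mem_archLocal_diagonal L N α w _⟩ * u⁻¹) * g⁻¹ : archLocal L N (Matrix.diagonal α) w) : GL (Fin N) ℂ) : Matrix (Fin N) (Fin N) ℂ)) =
      ((((g * u) * ⟨circleDiagonal N ζ, circleDiagonal_mem_archLocal_diagonal L N α w ζ⟩ * (g * u)⁻¹ : archLocal L N (Matrix.diagonal α) w) : GL (Fin N) ℂ) :
          Matrix (Fin N) (Fin N) ℂ)
        + (cexp (y * I) - 1) • ((ζ i : ℂ) • ((((g * u : archLocal L N (Matrix.diagonal α) w) : GL (Fin N) ℂ) : Matrix (Fin N) (Fin N) ℂ) * Matrix.single i i (1 : ℂ) *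
            ((((g * u)⁻¹ : archLocal L N (Matrix.diagonal α) w) : GL (Fin N) ℂ) : Matrix (Fin N) (Fin N) ℂ)))
        + (cexp (-(y * I)) - 1) • ((ζ j : ℂ) • ((((g * u : archLocal L N (Matrix.diagonal α) w) : GL (Fin N) ℂ) : Matrix (Fin N) (Fin N) ℂ) * Matrix.single j j (1 : ℂ) *
            ((((g * u)⁻¹ : archLocal L N (Matrix.diagonal α) w) : GL (Fin N) ℂ) : Matrix (Fin N) (Fin N) ℂ))) := by
  simp only [Subgroup.coe_mul, mul_inv_rev, Units.val_mul]
  rw [coe_circleDiagonal_wallLine_eq N hij, coe_circleDiagonal]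
  simp only [Matrix.mul_add, Matrix.add_mul, Matrix.mul_one, Matrix.mul_smul, Matrix.smul_mul, diagonal_mul_single_same, Matrix.mul_assoc]

/-- **ON THE CENTRALISER THE IDEMPOTENT `Q` FORGETS `m`**: if the `ζ`-class of `i` is `{i, j}` (`i ≠ j`) and `m ∈ Z_{G_w}(diag ζ)`, then for every `g ∈ G_w`
`↑↑(g m)·(E_ii + E_jj)·↑↑(g m)⁻¹ = ↑↑g·(E_ii + E_jj)·↑↑g⁻¹` (`m` commutes with `diag ζ`, hence with `E_ii + E_jj`). [cite: Rogawski1990, §8.2 p. 122] -/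
theorem conj_mul_single_add_single_conj_eq_of_mem_centralizer (ζ : Fin N → Circle) {i j : Fin N} (hij : i ≠ j)
    (hS : ∀ k, ζ k = ζ i ↔ (k = i ∨ k = j)) (g m : archLocal L N (Matrix.diagonal α) w)
    (hm : m ∈ Subgroup.centralizer ({(⟨circleDiagonal N ζ, circleDiagonal_mem_archLocal_diagonal L N α w ζ⟩ : archLocal L N (Matrix.diagonal α) w)} :
      Set (archLocal L N (Matrix.diagonal α) w))) :
    (((g * m : archLocal L N (Matrix.diagonal α) w) : GL (Fin N) ℂ) : Matrix (Fin N) (Fin N) ℂ) * (Matrix.single i i (1 : ℂ) + Matrix.single j j 1) *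
        ((((g * m)⁻¹ : archLocal L N (Matrix.diagonal α) w) : GL (Fin N) ℂ) : Matrix (Fin N) (Fin N) ℂ) =
      (((g : archLocal L N (Matrix.diagonal α) w) : GL (Fin N) ℂ) : Matrix (Fin N) (Fin N) ℂ) * (Matrix.single i i (1 : ℂ) + Matrix.single j j 1) *
        (((g⁻¹ : archLocal L N (Matrix.diagonal α) w) : GL (Fin N) ℂ) : Matrix (Fin N) (Fin N) ℂ) := by
  have hc : (⟨circleDiagonal N ζ, circleDiagonal_mem_archLocal_diagonal L N α w ζ⟩ : archLocal L N (Matrix.diagonal α) w) * m =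
      m * ⟨circleDiagonal N ζ, circleDiagonal_mem_archLocal_diagonal L N α w ζ⟩ :=
    Subgroup.mem_centralizer_iff.1 hm _ (Set.mem_singleton _)
  have hM : (((m : archLocal L N (Matrix.diagonal α) w) : GL (Fin N) ℂ) : Matrix (Fin N) (Fin N) ℂ) * Matrix.diagonal (fun k => (ζ k : ℂ)) =
      Matrix.diagonal (fun k => (ζ k : ℂ)) * (((m : archLocal L N (Matrix.diagonal α) w) : GL (Fin N) ℂ) : Matrix (Fin N) (Fin N) ℂ) := by
    have h := congrArg (fun x : archLocal L N (Matrix.diagonal α) w => ((x : GL (Fin N) ℂ) : Matrix (Fin N) (Fin N) ℂ)) hc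
    simp only [Subgroup.coe_mul, Units.val_mul, coe_circleDiagonal] at h
    exact h.symm
  have hS' : ∀ k, (ζ k : ℂ) = ζ i ↔ (k = i ∨ k = j) := fun k => by rw [← hS k]; exact ⟨fun h => Circle.ext h, fun h => by rw [h]⟩
  have hcomm := mul_single_add_single_eq_of_mul_diagonal_eq N hM hij hS'
  have hmm : (((m : archLocal L N (Matrix.diagonal α) w) : GL (Fin N) ℂ) : Matrix (Fin N) (Fin N) ℂ) *
      (((m⁻¹ : archLocal L N (Matrix.diagonal α) w) : GL (Fin N) ℂ) : Matrix (Fin N) (Fin N) ℂ) = 1 := by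
    rw [← Units.val_mul, ← Subgroup.coe_mul, mul_inv_cancel, Subgroup.coe_one, Units.val_one]
  rw [mul_inv_rev]
  simp only [Subgroup.coe_mul, Units.val_mul]
  calc (((g : archLocal L N (Matrix.diagonal α) w) : GL (Fin N) ℂ) : Matrix (Fin N) (Fin N) ℂ) *
          (((m : archLocal L N (Matrix.diagonal α) w) : GL (Fin N) ℂ) : Matrix (Fin N) (Fin N) ℂ) * (Matrix.single i i (1 : ℂ) + Matrix.single j j 1) *
          ((((m⁻¹ : archLocal L N (Matrix.diagonal α) w) : GL (Fin N) ℂ) : Matrix (Fin N) (Fin N) ℂ) *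
            (((g⁻¹ : archLocal L N (Matrix.diagonal α) w) : GL (Fin N) ℂ) : Matrix (Fin N) (Fin N) ℂ))
        = (((g : archLocal L N (Matrix.diagonal α) w) : GL (Fin N) ℂ) : Matrix (Fin N) (Fin N) ℂ) *
          ((((m : archLocal L N (Matrix.diagonal α) w) : GL (Fin N) ℂ) : Matrix (Fin N) (Fin N) ℂ) * (Matrix.single i i (1 : ℂ) + Matrix.single j j 1)) *
          (((m⁻¹ : archLocal L N (Matrix.diagonal α) w) : GL (Fin N) ℂ) : Matrix (Fin N) (Fin N) ℂ) *
            (((g⁻¹ : archLocal L N (Matrix.diagonal α) w) : GL (Fin N) ℂ) : Matrix (Fin N) (Fin N) ℂ) := by simp only [Matrix.mul_assoc]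
    _ = (((g : archLocal L N (Matrix.diagonal α) w) : GL (Fin N) ℂ) : Matrix (Fin N) (Fin N) ℂ) * (Matrix.single i i (1 : ℂ) + Matrix.single j j 1) *
          ((((m : archLocal L N (Matrix.diagonal α) w) : GL (Fin N) ℂ) : Matrix (Fin N) (Fin N) ℂ) *
            (((m⁻¹ : archLocal L N (Matrix.diagonal α) w) : GL (Fin N) ℂ) : Matrix (Fin N) (Fin N) ℂ)) *
            (((g⁻¹ : archLocal L N (Matrix.diagonal α) w) : GL (Fin N) ℂ) : Matrix (Fin N) (Fin N) ℂ) := by rw [hcomm]; simp only [Matrix.mul_assoc]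
    _ = _ := by rw [hmm, Matrix.mul_one]

variable {E : Type*} [NormedAddCommGroup E] [NormedSpace ℝ E]

/-- **THE POINTWISE FORMULA — TRANSVERSAL SECOND DERIVATIVE = HESSIAN + GRADIENT**: for `Θ : M_N(ℂ) → E` of class `C²` (over `ℝ`, `Matrix.Norms.Operator`), `i ≠ j`, `g u ∈ G_w`,
with `h := ↑↑((g u) t₀ (g u)⁻¹)`, `A := ↑↑(g u) E_ii ↑↑(g u)⁻¹`, `B := ↑↑(g u) E_jj ↑↑(g u)⁻¹`:
`∂²_y|₀ Θ(↑↑(g·(u·t_y·u⁻¹)·g⁻¹)) = D²Θ(h)[i•(ζ_i•A − ζ_j•B), i•(ζ_i•A − ζ_j•B)] − DΘ(h)[ζ_i•A + ζ_j•B]` (§1 on the curve of the previous theorem).  `Θ` is only `ℝ`-differentiable: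
the unit scalars stay inside the arguments. [cite: Rogawski1990, §8.4 p. 126] [cite: HormanderALPDO1, Thm. 1.1.7] -/
theorem iteratedDeriv_two_comp_conj_conj_circleDiagonal_wallLine_eq {i j : Fin N} (hij : i ≠ j) (ζ : Fin N → Circle)
    (Θ : Matrix (Fin N) (Fin N) ℂ → E) (hΘ : ContDiff ℝ 2 Θ) (g u : archLocal L N (Matrix.diagonal α) w) :
    iteratedDeriv 2 (fun y : ℝ =>
        Θ ((((g * (u * ⟨circleDiagonal N fun k => ζ k * Circle.exp (y * ((if k = i then 1 else 0) - (if k = j then 1 else 0))),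
          circleDiagonal_mem_archLocal_diagonal L N α w _⟩ * u⁻¹) * g⁻¹ : archLocal L N (Matrix.diagonal α) w) : GL (Fin N) ℂ) : Matrix (Fin N) (Fin N) ℂ))) 0 =
      iteratedFDeriv ℝ 2 Θ
          ((((g * u) * ⟨circleDiagonal N ζ, circleDiagonal_mem_archLocal_diagonal L N α w ζ⟩ * (g * u)⁻¹ : archLocal L N (Matrix.diagonal α) w) : GL (Fin N) ℂ) :
            Matrix (Fin N) (Fin N) ℂ)
          ![I • ((ζ i : ℂ) • ((((g * u : archLocal L N (Matrix.diagonal α) w) : GL (Fin N) ℂ) : Matrix (Fin N) (Fin N) ℂ) * Matrix.single i i (1 : ℂ) *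
                ((((g * u)⁻¹ : archLocal L N (Matrix.diagonal α) w) : GL (Fin N) ℂ) : Matrix (Fin N) (Fin N) ℂ)) -
              (ζ j : ℂ) • ((((g * u : archLocal L N (Matrix.diagonal α) w) : GL (Fin N) ℂ) : Matrix (Fin N) (Fin N) ℂ) * Matrix.single j j (1 : ℂ) *
                ((((g * u)⁻¹ : archLocal L N (Matrix.diagonal α) w) : GL (Fin N) ℂ) : Matrix (Fin N) (Fin N) ℂ))),
            I • ((ζ i : ℂ) • ((((g * u : archLocal L N (Matrix.diagonal α) w) : GL (Fin N) ℂ) : Matrix (Fin N) (Fin N) ℂ) * Matrix.single i i (1 : ℂ) *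
                ((((g * u)⁻¹ : archLocal L N (Matrix.diagonal α) w) : GL (Fin N) ℂ) : Matrix (Fin N) (Fin N) ℂ)) -
              (ζ j : ℂ) • ((((g * u : archLocal L N (Matrix.diagonal α) w) : GL (Fin N) ℂ) : Matrix (Fin N) (Fin N) ℂ) * Matrix.single j j (1 : ℂ) *
                ((((g * u)⁻¹ : archLocal L N (Matrix.diagonal α) w) : GL (Fin N) ℂ) : Matrix (Fin N) (Fin N) ℂ)))] -
        fderiv ℝ Θ
          ((((g * u) * ⟨circleDiagonal N ζ, circleDiagonal_mem_archLocal_diagonal L N α w ζ⟩ * (g * u)⁻¹ : archLocal L N (Matrix.diagonal α) w) : GL (Fin N) ℂ) :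
            Matrix (Fin N) (Fin N) ℂ)
          ((ζ i : ℂ) • ((((g * u : archLocal L N (Matrix.diagonal α) w) : GL (Fin N) ℂ) : Matrix (Fin N) (Fin N) ℂ) * Matrix.single i i (1 : ℂ) *
              ((((g * u)⁻¹ : archLocal L N (Matrix.diagonal α) w) : GL (Fin N) ℂ) : Matrix (Fin N) (Fin N) ℂ)) +
            (ζ j : ℂ) • ((((g * u : archLocal L N (Matrix.diagonal α) w) : GL (Fin N) ℂ) : Matrix (Fin N) (Fin N) ℂ) * Matrix.single j j (1 : ℂ) *
              ((((g * u)⁻¹ : archLocal L N (Matrix.diagonal α) w) : GL (Fin N) ℂ) : Matrix (Fin N) (Fin N) ℂ))) := by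
  have hcurve : (fun y : ℝ =>
        Θ ((((g * (u * ⟨circleDiagonal N fun k => ζ k * Circle.exp (y * ((if k = i then 1 else 0) - (if k = j then 1 else 0))),
          circleDiagonal_mem_archLocal_diagonal L N α w _⟩ * u⁻¹) * g⁻¹ : archLocal L N (Matrix.diagonal α) w) : GL (Fin N) ℂ) : Matrix (Fin N) (Fin N) ℂ))) =
      fun y : ℝ => Θ (((((g * u) * ⟨circleDiagonal N ζ, circleDiagonal_mem_archLocal_diagonal L N α w ζ⟩ * (g * u)⁻¹ : archLocal L N (Matrix.diagonal α) w) :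
            GL (Fin N) ℂ) : Matrix (Fin N) (Fin N) ℂ)
        + (cexp (y * I) - 1) • ((ζ i : ℂ) • ((((g * u : archLocal L N (Matrix.diagonal α) w) : GL (Fin N) ℂ) : Matrix (Fin N) (Fin N) ℂ) * Matrix.single i i (1 : ℂ) *
            ((((g * u)⁻¹ : archLocal L N (Matrix.diagonal α) w) : GL (Fin N) ℂ) : Matrix (Fin N) (Fin N) ℂ)))
        + (cexp (-(y * I)) - 1) • ((ζ j : ℂ) • ((((g * u : archLocal L N (Matrix.diagonal α) w) : GL (Fin N) ℂ) : Matrix (Fin N) (Fin N) ℂ) * Matrix.single j j (1 : ℂ) *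
            ((((g * u)⁻¹ : archLocal L N (Matrix.diagonal α) w) : GL (Fin N) ℂ) : Matrix (Fin N) (Fin N) ℂ)))) :=
    funext fun y => by rw [coe_conj_conj_circleDiagonal_wallLine_eq L N α w hij]
  rw [hcurve]
  exact iteratedDeriv_two_comp_expCurve Θ hΘ _ _ _

end Conjugate

/-! ## §3 At a compact wall: `N²Φ` as a Hessian-minus-gradient integral along every transversal of `Z(t₀)` -/

section WallHessian

variable (L : Type) [Field L] (N : ℕ) (α : Fin N → L) (w : {w : InfinitePlace L // IsComplex w})
  {E : Type*} [NormedAddCommGroup E] [NormedSpace ℝ E] [CompleteSpace E]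
  [MeasurableSpace (archLocal L N (Matrix.diagonal α) w)] [BorelSpace (archLocal L N (Matrix.diagonal α) w)]

/-- **`N²Φ|_{wall}` AS A HESSIAN-MINUS-GRADIENT INTEGRAL, ALONG EVERY TRANSVERSAL OF THE COMPACT CENTRALISER**: under the hypotheses of ★ (A2′) (`e_k` real non-zero, constant-sign
labelling `b`, `ζ` block-separated for `b`, `Θ` smooth with compact support on `G_w`, `ν` right-invariant and finite on compacts), at a COMPACT-WALL point (`i ≠ j`, `ζ_i = ζ_j`, the
`b`-block of `i` is `{i, j}`), for EVERY `m ∈ Z_{G_w}(t₀)`: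
`∂²_y|₀ ∫ Θ(↑↑(g t_y g⁻¹)) dν = ∫ ( D²Θ(h_g)[X_{g m}, X_{g m}] − DΘ(h_g)[ζ_i • Q_g] ) dν(g)`, `h_g = ↑↑(g t₀ g⁻¹)`, `Q_g = ↑↑g (E_ii + E_jj) ↑↑g⁻¹`,
`X_{g m} = (i ζ_i) • ↑↑(g m)(E_ii − E_jj)↑↑(g m)⁻¹` (★ (A2′) `…wallLine_eq_integral_conj` at `u := m`, the pointwise formula, §3).  The gradient term is `m`-free; the Hessian term sees
`m` only through the transversal unit vector `Ad(g m)(E_ii − E_jj)` — part 2b averages it over `Z(t₀)`. [cite: Rogawski1990, §8.2 pp. 122–123; §8.4 p. 126]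
[cite: Varadarajan1989, §6.4] -/
theorem iteratedDeriv_two_integral_wallLine_eq_integral_hessian_sub_gradient (hα : ∀ i, α i ≠ 0) (hreal : ∀ i, (w.1.embedding (α i)).im = 0)
    {ι : Type*} (b : Fin N → ι) (hsign : ∀ i j, i ≠ j → b i = b j → 0 < (w.1.embedding (α i)).re * (w.1.embedding (α j)).re)
    (ν : Measure (archLocal L N (Matrix.diagonal α) w)) [IsFiniteMeasureOnCompacts ν] [ν.IsMulRightInvariant]
    (Θ : Matrix (Fin N) (Fin N) ℂ → E) (hΘ : ContDiff ℝ ∞ Θ) (hfc : HasCompactSupport fun k : archLocal L N (Matrix.diagonal α) w => Θ (((k : GL (Fin N) ℂ) : Matrix (Fin N) (Fin N) ℂ)))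
    (ζ : Fin N → Circle) (hζ : ∀ k l, b k ≠ b l → ζ k ≠ ζ l) {i j : Fin N} (hij : i ≠ j) (hζij : ζ i = ζ j) (hb : ∀ k, b k = b i ↔ (k = i ∨ k = j))
    (m : archLocal L N (Matrix.diagonal α) w)
    (hm : m ∈ Subgroup.centralizer ({(⟨circleDiagonal N ζ, circleDiagonal_mem_archLocal_diagonal L N α w ζ⟩ : archLocal L N (Matrix.diagonal α) w)} :
      Set (archLocal L N (Matrix.diagonal α) w))) :
    iteratedDeriv 2 (fun y : ℝ => ∫ g : archLocal L N (Matrix.diagonal α) w,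
        Θ ((((g * ⟨circleDiagonal N fun k => ζ k * Circle.exp (y * ((if k = i then 1 else 0) - (if k = j then 1 else 0))),
          circleDiagonal_mem_archLocal_diagonal L N α w _⟩ * g⁻¹ : archLocal L N (Matrix.diagonal α) w) : GL (Fin N) ℂ) : Matrix (Fin N) (Fin N) ℂ)) ∂ν) 0 =
      ∫ g : archLocal L N (Matrix.diagonal α) w,
        (iteratedFDeriv ℝ 2 Θ
            (((g * ⟨circleDiagonal N ζ, circleDiagonal_mem_archLocal_diagonal L N α w ζ⟩ * g⁻¹ : archLocal L N (Matrix.diagonal α) w) : GL (Fin N) ℂ) :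
              Matrix (Fin N) (Fin N) ℂ)
            ![(I * (ζ i : ℂ)) • ((((g * m : archLocal L N (Matrix.diagonal α) w) : GL (Fin N) ℂ) : Matrix (Fin N) (Fin N) ℂ) *
                (Matrix.single i i (1 : ℂ) - Matrix.single j j 1) * ((((g * m)⁻¹ : archLocal L N (Matrix.diagonal α) w) : GL (Fin N) ℂ) : Matrix (Fin N) (Fin N) ℂ)),
              (I * (ζ i : ℂ)) • ((((g * m : archLocal L N (Matrix.diagonal α) w) : GL (Fin N) ℂ) : Matrix (Fin N) (Fin N) ℂ) *
                (Matrix.single i i (1 : ℂ) - Matrix.single j j 1) * ((((g * m)⁻¹ : archLocal L N (Matrix.diagonal α) w) : GL (Fin N) ℂ) : Matrix (Fin N) (Fin N) ℂ))] -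
          fderiv ℝ Θ
            (((g * ⟨circleDiagonal N ζ, circleDiagonal_mem_archLocal_diagonal L N α w ζ⟩ * g⁻¹ : archLocal L N (Matrix.diagonal α) w) : GL (Fin N) ℂ) :
              Matrix (Fin N) (Fin N) ℂ)
            ((ζ i : ℂ) • ((((g : archLocal L N (Matrix.diagonal α) w) : GL (Fin N) ℂ) : Matrix (Fin N) (Fin N) ℂ) * (Matrix.single i i (1 : ℂ) + Matrix.single j j 1) *
              (((g⁻¹ : archLocal L N (Matrix.diagonal α) w) : GL (Fin N) ℂ) : Matrix (Fin N) (Fin N) ℂ)))) ∂ν := by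
  rw [iteratedDeriv_two_integral_comp_conj_circleDiagonal_wallLine_eq_integral_conj L N α w hα hreal b hsign ν Θ hΘ hfc ζ hζ i j m]
  congr 1
  funext g
  rw [iteratedDeriv_two_comp_conj_conj_circleDiagonal_wallLine_eq L N α w hij ζ Θ (hΘ.of_le (WithTop.coe_le_coe.2 le_top)) g m]
  have hS : ∀ k, ζ k = ζ i ↔ (k = i ∨ k = j) := fun k => by
    refine ⟨fun h => ?_, fun h => ?_⟩
    · by_contra hk
      exact hζ k i (fun hbk => hk ((hb k).1 hbk)) h
    · rcases h with h | h
      · rw [h]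
      · rw [h, hζij]
  have ht : (g * m) * (⟨circleDiagonal N ζ, circleDiagonal_mem_archLocal_diagonal L N α w ζ⟩ : archLocal L N (Matrix.diagonal α) w) * (g * m)⁻¹ =
      g * ⟨circleDiagonal N ζ, circleDiagonal_mem_archLocal_diagonal L N α w ζ⟩ * g⁻¹ := by
    have hc : (⟨circleDiagonal N ζ, circleDiagonal_mem_archLocal_diagonal L N α w ζ⟩ : archLocal L N (Matrix.diagonal α) w) * m =
        m * ⟨circleDiagonal N ζ, circleDiagonal_mem_archLocal_diagonal L N α w ζ⟩ :=
      Subgroup.mem_centralizer_iff.1 hm _ (Set.mem_singleton _)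
    rw [mul_inv_rev, mul_assoc g m, ← hc, ← mul_assoc, ← mul_assoc, mul_assoc (g * _) m, mul_inv_cancel, mul_one]
  have hζj : ((ζ j : Circle) : ℂ) = (ζ i : ℂ) := by rw [hζij]
  have hX : I • ((ζ i : ℂ) • ((((g * m : archLocal L N (Matrix.diagonal α) w) : GL (Fin N) ℂ) : Matrix (Fin N) (Fin N) ℂ) * Matrix.single i i (1 : ℂ) *
        ((((g * m)⁻¹ : archLocal L N (Matrix.diagonal α) w) : GL (Fin N) ℂ) : Matrix (Fin N) (Fin N) ℂ)) -
      (ζ i : ℂ) • ((((g * m : archLocal L N (Matrix.diagonal α) w) : GL (Fin N) ℂ) : Matrix (Fin N) (Fin N) ℂ) * Matrix.single j j (1 : ℂ) *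
        ((((g * m)⁻¹ : archLocal L N (Matrix.diagonal α) w) : GL (Fin N) ℂ) : Matrix (Fin N) (Fin N) ℂ))) =
      (I * (ζ i : ℂ)) • ((((g * m : archLocal L N (Matrix.diagonal α) w) : GL (Fin N) ℂ) : Matrix (Fin N) (Fin N) ℂ) *
        (Matrix.single i i (1 : ℂ) - Matrix.single j j 1) * ((((g * m)⁻¹ : archLocal L N (Matrix.diagonal α) w) : GL (Fin N) ℂ) : Matrix (Fin N) (Fin N) ℂ)) := by
    rw [← smul_sub, smul_smul, Matrix.mul_sub, Matrix.sub_mul]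
  have hQ : (ζ i : ℂ) • ((((g * m : archLocal L N (Matrix.diagonal α) w) : GL (Fin N) ℂ) : Matrix (Fin N) (Fin N) ℂ) * Matrix.single i i (1 : ℂ) *
        ((((g * m)⁻¹ : archLocal L N (Matrix.diagonal α) w) : GL (Fin N) ℂ) : Matrix (Fin N) (Fin N) ℂ)) +
      (ζ i : ℂ) • ((((g * m : archLocal L N (Matrix.diagonal α) w) : GL (Fin N) ℂ) : Matrix (Fin N) (Fin N) ℂ) * Matrix.single j j (1 : ℂ) *
        ((((g * m)⁻¹ : archLocal L N (Matrix.diagonal α) w) : GL (Fin N) ℂ) : Matrix (Fin N) (Fin N) ℂ)) =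
      (ζ i : ℂ) • ((((g : archLocal L N (Matrix.diagonal α) w) : GL (Fin N) ℂ) : Matrix (Fin N) (Fin N) ℂ) * (Matrix.single i i (1 : ℂ) + Matrix.single j j 1) *
        (((g⁻¹ : archLocal L N (Matrix.diagonal α) w) : GL (Fin N) ℂ) : Matrix (Fin N) (Fin N) ℂ)) := by
    rw [← smul_add, ← Matrix.add_mul, ← Matrix.mul_add, conj_mul_single_add_single_conj_eq_of_mem_centralizer L N α w ζ hij hS g m hm]
  rw [hζj, hX, hQ, ht]

end WallHessian

/-! ## §4 `N = 3`, `(i, j) = (0, 1)`: the gradient idempotent is `1 −` the conjugate of `diag(0,0,1)` (the pencil of ★ (A3-a)) -/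

section ThreeByThree

variable (L : Type) [Field L] (α : Fin 3 → L) (w : {w : InfinitePlace L // IsComplex w})

/-- `E₀₀ + E₁₁ = 1 − diag(0,0,1)` in `M₃(ℂ)` (private plumbing). [folklore] -/
private theorem single_zero_add_single_one_eq_one_sub_diagonal :
    Matrix.single (0 : Fin 3) 0 (1 : ℂ) + Matrix.single 1 1 1 = 1 - Matrix.diagonal ![(0 : ℂ), 0, 1] := by
  rw [← Matrix.diagonal_single, ← Matrix.diagonal_single, Matrix.diagonal_add, ← Matrix.diagonal_one, Matrix.diagonal_sub]
  congr 1
  funext k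
  fin_cases k <;> simp

/-- **THE `N = 3` READING**: for `g ∈ G_w = archLocal L 3 (diagonal α) w`, `↑↑g·(E₀₀ + E₁₁)·↑↑g⁻¹ = 1 − ↑↑g·diag(0,0,1)·↑↑g⁻¹`; at `α = (1, 1, −1)` (`H_w = J = diag(1,1,−1)`) the subtracted
matrix is the rank-one idempotent `P(lift (g • x₀))` of ★ (A3-a) `mat_conj_kCentral_eq`, so the gradient term of §3 reads `−DΘ(u•1 + (v − u)•P)[u•(1 − P)]` on the ball `𝔹²`.
[cite: Rogawski1990, §8.4 pp. 126–127] -/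
theorem conj_single_add_single_eq_one_sub_conj_diagonal (g : archLocal L 3 (Matrix.diagonal α) w) :
    (((g : archLocal L 3 (Matrix.diagonal α) w) : GL (Fin 3) ℂ) : Matrix (Fin 3) (Fin 3) ℂ) * (Matrix.single (0 : Fin 3) 0 (1 : ℂ) + Matrix.single 1 1 1) *
        (((g⁻¹ : archLocal L 3 (Matrix.diagonal α) w) : GL (Fin 3) ℂ) : Matrix (Fin 3) (Fin 3) ℂ) =
      1 - (((g : archLocal L 3 (Matrix.diagonal α) w) : GL (Fin 3) ℂ) : Matrix (Fin 3) (Fin 3) ℂ) * Matrix.diagonal ![(0 : ℂ), 0, 1] *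
        (((g⁻¹ : archLocal L 3 (Matrix.diagonal α) w) : GL (Fin 3) ℂ) : Matrix (Fin 3) (Fin 3) ℂ) := by
  have hgg : (((g : archLocal L 3 (Matrix.diagonal α) w) : GL (Fin 3) ℂ) : Matrix (Fin 3) (Fin 3) ℂ) *
      (((g⁻¹ : archLocal L 3 (Matrix.diagonal α) w) : GL (Fin 3) ℂ) : Matrix (Fin 3) (Fin 3) ℂ) = 1 := by
    rw [← Units.val_mul, ← Subgroup.coe_mul, mul_inv_cancel, Subgroup.coe_one, Units.val_one]
  rw [single_zero_add_single_one_eq_one_sub_diagonal, Matrix.mul_sub, Matrix.sub_mul, Matrix.mul_one, hgg]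

end ThreeByThree

end Literature.NumberTheory.Automorphic.UnitaryGroup
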